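import Literature.AlgebraicGeometry.Resolution.HypersurfaceMaxOrderTransform
import Literature.AlgebraicGeometry.Resolution.RestrictionPropertyCartier
import Literature.AlgebraicGeometry.Resolution.RegularSubschemeLocallyIrreducible
import Literature.AlgebraicGeometry.Resolution.BlowupSequencesExtensions
import Literature.AlgebraicGeometry.Resolution.BlowupsProduct
import HarnessLib

/-!
# Route `HilbertSamuelElimination`, crux `SigmaMaxModificationsCorridor3`
# (stmt-ResolutionOfSingularities-19249; child of `SigmaMaxModifications` stmt-…-18506),
# line `tame_wild` v3 — brick T1, step 1: THE RESTRICTION PROPERTY AT MAXIMAL ORDER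

[OURS · L1 W4.2] First step of the per-chart transfer `stub_T1_chartTransfer` (lead's helper
programme v3, hypothesis `hT1` of `TameWild.confinedNu3_of_bricks`, p480768): the embedded tower of a
SINGULAR hypersurface of maximal order along the centre. NOT a statement of any manuscript.

Let `X` be locally Noetherian and regular, `π : X' → X` a blow-up along `C` with `V(C)` regular,
`H` a HYPERSURFACE (principal stalks) of order `μ` at every point of `V(C)` (Kollár 2007, 3.58–3.60:
"if `mult_Z X = m` then `π^* X = m E + X'`"), `H' = (π^*H : 𝓘(D)^μ)` its weak (= strict, tree
`IsBlowup.strictTransformIdeal_eq_controlledTransform_of_forall_isPrincipal`) transform. PROVED: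

* `comap_le_pow_comap_of_maxOrder` — `π^*H ⊆ 𝓘(D)^μ` (from the chart computation
  `H_x 𝒪_{X',x'} = (e^μ g')` of `HypersurfaceMaxOrderTransform.lean`);
* `exists_generators_controlledTransform_of_maxOrder` — at a point `x'` over the centre,
  `𝓘(D)_{x'} = (e)`, `H'_{x'} = (g)` with `e` a prime nonzerodivisor and `g ∉ (e)`;
* `IsBlowup.isEffectiveCartier_comap_subschemeι_controlledTransform_of_maxOrder` — **the
  exceptional divisor restricts to an effective Cartier divisor on `V(H')`** (`e` is a nonzerodivisor
  modulo `g`: `e s = g t ⇒ e ∣ t`);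
* `IsBlowup.isBlowup_subscheme_controlledTransform_of_le_pow` — the formal half of the restriction
  property for ANY exponent (the tree's `…_of_isEffectiveCartier` is `μ = 1`), whence
* `IsBlowup.isBlowup_subscheme_controlledTransform_of_maxOrder` — **the restriction property at
  maximal order**: `V(H') → V(H)` IS the blow-up of the hypersurface `V(H)` along `C|_{V(H)}`
  (generalises the tree's `IsBlowup.isBlowup_subscheme_controlledTransform`, the case of a REGULAR
  hypersurface, `μ = 1`; BGMW §4 Remark (3) / GW 13.96 (2));
* `IsBlowup.ker_strictTransformHom_of_maxOrder`, `ker_comapMap_of_maxOrder` — **the ideal of the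
  strict transform of the hypersurface `W ↪ X` (`ker` of `Bl_C(W) ↪ Bl_C(X)`, Kollár 3.30.2) is
  `(π^*(ker) : 𝓘(D)^μ)`** — the kernel identity consumed by the induced sequence `t.comap ι` of T1.

## Sources

* J. Kollár, *Lectures on Resolution of Singularities* (2007), 3.58–3.60, Def. 3.30. [Kollar2007]
* E. Bierstone, D. Grigoriev, P. Milman, J. Włodarczyk, arXiv:1206.3090, §4 Remark (3),
  Lemma 3.6.4 (6). [BierstoneGrigorievMilmanWlodarczyk2011]
* U. Görtz, T. Wedhorn, *Algebraic Geometry I* (2020), Prop. 13.91 (1), 13.96 (2). [GortzWedhorn2020]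
-/

set_option linter.dupNamespace false -- mandated namespace of this single-conjunct summit

noncomputable section

open CategoryTheory CategoryTheory.Limits AlgebraicGeometry TopologicalSpace IsLocalRing
open Literature.AlgebraicGeometry.Resolution Scheme.IdealSheafData

namespace Summit.ResolutionOfSingularities.ResolutionOfSingularities.Theorems.SigmaMaxModificationsCorridor3.Helpers

universe u

/-! ## `π^*H ⊆ 𝓘(D)^μ` and linked stalk generators -/

section Stalks

variable {X X' : Scheme.{u}} [IsLocallyNoetherian X] {π : X' ⟶ X} {C H : X.IdealSheafData} {μ : ℕ}

/-- **`π^*H ⊆ 𝓘(D)^μ` for a hypersurface of order `μ` along the regular centre** (Kollár 3.60: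
`π^* X = m E + X'`): stalkwise `H_x 𝒪_{X',x'} = (e^μ g') ⊆ (e)^μ = 𝓘(D)_{x'}^μ` over the centre, and
`𝓘(D)_{x'} = 𝒪` off it. [cite: Kollar2007, 3.58–3.60] -/
theorem comap_le_pow_comap_of_maxOrder (hX : Scheme.IsRegular X) (hC : Scheme.IsRegular C.subscheme)
    (hπ : IsBlowup π C) (hμ : ∀ y ∈ (C.support : Set X), idealOrder H y = μ)
    (hH : ∀ x, (stalkIdeal H x).IsPrincipal) : H.comap π ≤ C.comap π ^ μ := by
  haveI : IsProper π := hπ.isProper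
  haveI : IsLocallyNoetherian X' := LocallyOfFiniteType.isLocallyNoetherian π
  have hCY : C = vanishingIdeal C.support := eq_vanishingIdeal_support_of_isRegular C hC
  have hπ' : IsBlowup π (vanishingIdeal C.support) := by rw [← hCY]; exact hπ
  have hreg' : Scheme.IsRegular (vanishingIdeal C.support).subscheme := by rw [← hCY]; exact hC
  refine le_of_forall_stalkIdeal_le fun x' => ?_
  by_cases hx : π x' ∈ (C.support : Set X)
  · obtain ⟨e, g', hE, hmap, -, -, -⟩ :=
      hπ'.exists_stalkIdeal_map_eq_span_pow_mul hX hreg' hμ hx (hH _)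
    rw [← hCY] at hE
    rw [stalkIdeal_comap_eq_map_stalkMap, hmap, stalkIdeal_pow, hE, Ideal.span_singleton_pow,
      Ideal.span_singleton_le_iff_mem]
    exact Ideal.mem_span_singleton'.mpr ⟨g', by ring⟩
  · have hx' : x' ∉ (C.comap π).support := by
      rw [Scheme.IdealSheafData.support_comap]; exact hx
    rw [stalkIdeal_pow, stalkIdeal_eq_top_of_not_mem_support hx', Ideal.top_pow]
    exact le_top

/-- **Linked generators over the centre.** At a point `x'` of the blow-up over the centre:
`𝓘(D)_{x'} = (e)` and `H'_{x'} = (g)` for the weak transform `H' = (π^*H : 𝓘(D)^μ)`, with `e` a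
nonzerodivisor generating a prime ideal and `g ∉ (e)` (Kollár 3.60: the birational transform does
not contain `E`; CoP1 (11)). [cite: Kollar2007, 3.58–3.60] [cite: CossartPiltant2008, proof of Prop. 4.2, (10)–(11)] -/
theorem exists_generators_controlledTransform_of_maxOrder (hX : Scheme.IsRegular X)
    (hC : Scheme.IsRegular C.subscheme) (hπ : IsBlowup π C)
    (hμ : ∀ y ∈ (C.support : Set X), idealOrder H y = μ) (hH : ∀ x, (stalkIdeal H x).IsPrincipal)
    {x' : X'} (hx : π x' ∈ (C.support : Set X)) :
    ∃ e g : X'.presheaf.stalk x', stalkIdeal (C.comap π) x' = Ideal.span {e} ∧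
      stalkIdeal (controlledTransform π C H μ) x' = Ideal.span {g} ∧
      e ∈ nonZeroDivisors (X'.presheaf.stalk x') ∧ (Ideal.span {e}).IsPrime ∧
      g ∉ Ideal.span {e} := by
  haveI : IsProper π := hπ.isProper
  haveI : IsLocallyNoetherian X' := LocallyOfFiniteType.isLocallyNoetherian π
  have hCY : C = vanishingIdeal C.support := eq_vanishingIdeal_support_of_isRegular C hC
  have hπ' : IsBlowup π (vanishingIdeal C.support) := by rw [← hCY]; exact hπ
  have hreg' : Scheme.IsRegular (vanishingIdeal C.support).subscheme := by rw [← hCY]; exact hC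
  obtain ⟨e, g', hE, hmap, he, hprime, hg'⟩ :=
    hπ'.exists_stalkIdeal_map_eq_span_pow_mul hX hreg' hμ hx (hH _)
  obtain ⟨g, hg, -⟩ := hπ'.stalkIdeal_transforms_eq_span_of_isPrincipal hX hreg' hμ hx (hH _)
  rw [← hCY] at hE hg
  have hle : H.comap π ≤ C.comap π ^ μ := comap_le_pow_comap_of_maxOrder hX hC hπ hμ hH
  have hprod := pow_mul_controlledTransform_eq π C (I := H) (μ := μ) hπ.isEffectiveCartier hle
  have hst : stalkIdeal (C.comap π ^ μ * controlledTransform π C H μ) x' =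
      stalkIdeal (H.comap π) x' := by rw [hprod]
  rw [stalkIdeal_mul, stalkIdeal_pow, hE, hg, stalkIdeal_comap_eq_map_stalkMap, hmap,
    Ideal.span_singleton_pow, Ideal.span_singleton_mul_span_singleton] at hst
  have hmem : e ^ μ * g' ∈ Ideal.span {e ^ μ * g} := by
    rw [hst]; exact Ideal.mem_span_singleton_self _
  obtain ⟨c, hc⟩ := Ideal.mem_span_singleton'.mp hmem
  have hg'c : g' = c * g := by
    have h1 : e ^ μ * g' = e ^ μ * (c * g) := by rw [← hc]; ring
    exact (mul_cancel_left_mem_nonZeroDivisors (pow_mem he μ)).mp h1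
  refine ⟨e, g, hE, hg, he, hprime, fun hge => hg' ?_⟩
  rw [hg'c]
  exact Ideal.mul_mem_left _ c hge

end Stalks

/-! ## The exceptional divisor restricts to an effective Cartier divisor on `V(H')` -/

section Local

variable {X X' : Scheme.{u}} [IsLocallyNoetherian X] {π : X' ⟶ X} {C H : X.IdealSheafData} {μ : ℕ}

/-- **The equation of the exceptional divisor is a nonzerodivisor modulo `H'` on an affine open**
(`H' = (π^*H : 𝓘(D)^μ)`, `H` a hypersurface of order `μ` along the regular centre): if `s g₀ ∈ H'(V)`
with `𝓘(D)(V) = (g₀)` then `s ∈ H'(V)`. Checked at the stalks: over the centre `H'_y = (g)`,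
`𝓘(D)_y = (e)` with `(e)` prime, `g ∉ (e)`, so `e s = g t` forces `e ∣ t` and `s ∈ (g)`; off the
centre `g₀` is a unit. [cite: Kollar2007, 3.58–3.60] -/
theorem mem_ideal_of_mul_mem_of_maxOrder (hX : Scheme.IsRegular X) (hC : Scheme.IsRegular C.subscheme)
    (hπ : IsBlowup π C) (hμ : ∀ y ∈ (C.support : Set X), idealOrder H y = μ)
    (hH : ∀ x, (stalkIdeal H x).IsPrincipal)
    (V : X'.affineOpens) {g₀ : Γ(X', V)} (hDV : (C.comap π).ideal V = Ideal.span {g₀})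
    {s : Γ(X', V)} (hs : s * g₀ ∈ (controlledTransform π C H μ).ideal V) :
    s ∈ (controlledTransform π C H μ).ideal V := by
  haveI : IsProper π := hπ.isProper
  haveI : IsLocallyNoetherian X' := LocallyOfFiniteType.isLocallyNoetherian π
  refine Ideal.mem_of_localization_maximal fun P hP => ?_
  let p : PrimeSpectrum Γ(X', V) := ⟨P, hP.isPrime⟩
  have hy : V.2.fromSpec p ∈ (V : X'.Opens) := V.2.range_fromSpec.le ⟨p, rfl⟩
  letI alg : Algebra Γ(X', V) (X'.presheaf.stalk (V.2.fromSpec p)) :=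
    (X'.presheaf.germ V _ hy).hom.toAlgebra
  haveI : IsLocalization.AtPrime (X'.presheaf.stalk (V.2.fromSpec p)) P :=
    V.2.isLocalization_stalk' p hy
  suffices hst : (X'.presheaf.germ V _ hy).hom s ∈ stalkIdeal (controlledTransform π C H μ)
      (V.2.fromSpec p) by
    let ε := (IsLocalization.algEquiv P.primeCompl (X'.presheaf.stalk (V.2.fromSpec p))
      (Localization.AtPrime P))
    have h1 : ((stalkIdeal (controlledTransform π C H μ) (V.2.fromSpec p)).map ε.toRingEquiv.toRingHom) =
        ((controlledTransform π C H μ).ideal V).map (algebraMap _ (Localization.AtPrime P)) := by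
      rw [stalkIdeal_eq_map_germ _ V hy, Ideal.map_map]
      congr 1
      ext a
      exact ε.commutes a
    rw [← h1]
    have h2 : algebraMap Γ(X', V) (Localization.AtPrime P) s =
        ε.toRingEquiv.toRingHom ((X'.presheaf.germ V _ hy).hom s) := (ε.commutes s).symm
    rw [h2]
    exact Ideal.mem_map_of_mem _ hst
  have hprod : (X'.presheaf.germ V _ hy).hom s * (X'.presheaf.germ V _ hy).hom g₀ ∈
      stalkIdeal (controlledTransform π C H μ) (V.2.fromSpec p) := by
    rw [← map_mul, stalkIdeal_eq_map_germ _ V hy]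
    exact Ideal.mem_map_of_mem _ hs
  have hDy : stalkIdeal (C.comap π) (V.2.fromSpec p) =
      Ideal.span {(X'.presheaf.germ V _ hy).hom g₀} := by
    rw [stalkIdeal_eq_map_germ _ V hy, hDV, Ideal.map_span, Set.image_singleton]
  by_cases hyC : π (V.2.fromSpec p) ∈ (C.support : Set X)
  · obtain ⟨e, g, hE, hg, he, hprime, hge⟩ :=
      exists_generators_controlledTransform_of_maxOrder hX hC hπ hμ hH hyC
    rw [hg] at hprod ⊢
    generalize hσ : (X'.presheaf.germ V _ hy).hom s = σs at hprod ⊢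
    generalize hγ : (X'.presheaf.germ V _ hy).hom g₀ = γ at hDy hprod
    have hγe : Ideal.span {γ} = Ideal.span {e} := by rw [← hDy, hE]
    obtain ⟨u, hu⟩ := Ideal.mem_span_singleton'.mp
      (show γ ∈ Ideal.span {e} by rw [← hγe]; exact Ideal.mem_span_singleton_self γ)
    obtain ⟨v, hv⟩ := Ideal.mem_span_singleton'.mp
      (show e ∈ Ideal.span {γ} by rw [hγe]; exact Ideal.mem_span_singleton_self e)
    have hvu : v * u = 1 := by
      have h1 : e * (v * u) = e * 1 := by
        calc e * (v * u) = v * (u * e) := by ring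
          _ = e * 1 := by rw [hu, hv, mul_one]
      exact (mul_cancel_left_mem_nonZeroDivisors he).mp h1
    rw [← hu] at hprod
    obtain ⟨t, ht⟩ := Ideal.mem_span_singleton'.mp hprod
    have hte : g * t ∈ Ideal.span {e} :=
      Ideal.mem_span_singleton'.mpr ⟨σs * u, by rw [mul_comm g t, ht]; ring⟩
    have ht' : t ∈ Ideal.span {e} := (hprime.mem_or_mem hte).resolve_left hge
    obtain ⟨t', ht'e⟩ := Ideal.mem_span_singleton'.mp ht'
    have hsu : σs * u = t' * g := by
      have h1 : e * (σs * u) = e * (t' * g) := by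
        calc e * (σs * u) = σs * (u * e) := by ring
          _ = t * g := ht.symm
          _ = (t' * e) * g := by rw [ht'e]
          _ = e * (t' * g) := by ring
      exact (mul_cancel_left_mem_nonZeroDivisors he).mp h1
    have hs' : σs = (v * t') * g := by
      calc σs = σs * (v * u) := by rw [hvu, mul_one]
        _ = v * (σs * u) := by ring
        _ = v * (t' * g) := by rw [hsu]
        _ = (v * t') * g := by ring
    rw [hs']
    exact Ideal.mul_mem_left _ _ (Ideal.mem_span_singleton_self g)
  · have hxD : V.2.fromSpec p ∉ (C.comap π).support := by
      rw [Scheme.IdealSheafData.support_comap]; exact hyC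
    have htop : Ideal.span {(X'.presheaf.germ V _ hy).hom g₀} = ⊤ := by
      rw [← hDy, stalkIdeal_eq_top_of_not_mem_support hxD]
    have hunit : IsUnit ((X'.presheaf.germ V _ hy).hom g₀) := Ideal.span_singleton_eq_top.mp htop
    exact (Ideal.unit_mul_mem_iff_mem _ hunit).mp (by rw [mul_comm]; exact hprod)

/-- **The exceptional divisor restricts to an effective Cartier divisor on the weak transform
`V(H')` of a hypersurface of maximal order** (Kollár 3.60: `X'` does not contain `E`).
[cite: Kollar2007, 3.58–3.60] [cite: BierstoneGrigorievMilmanWlodarczyk2011, Lemma 3.6.4 (6)] -/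
theorem IsBlowup.isEffectiveCartier_comap_subschemeι_controlledTransform_of_maxOrder
    (hX : Scheme.IsRegular X) (hC : Scheme.IsRegular C.subscheme) (hπ : IsBlowup π C)
    (hμ : ∀ y ∈ (C.support : Set X), idealOrder H y = μ) (hH : ∀ x, (stalkIdeal H x).IsPrincipal) :
    IsEffectiveCartier ((C.comap π).comap (controlledTransform π C H μ).subschemeι) := by
  intro s
  obtain ⟨V, hxV, g₀, hg₀, hDV⟩ :=
    hπ.isEffectiveCartier ((controlledTransform π C H μ).subschemeι s)
  let U' : (controlledTransform π C H μ).subscheme.affineOpens :=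
    ⟨(controlledTransform π C H μ).subschemeι ⁻¹ᵁ (V : X'.Opens), V.2.preimage _⟩
  have hsU' : s ∈ (U' : (controlledTransform π C H μ).subscheme.Opens) := hxV
  refine ⟨U', hsU', (controlledTransform π C H μ).subschemeι.app V g₀, ?_, ?_⟩
  · rw [mem_nonZeroDivisors_iff_right]
    intro y hy
    obtain ⟨s₁, rfl⟩ := (controlledTransform π C H μ).subschemeι_app_surjective V y
    have hmem : s₁ * g₀ ∈ RingHom.ker ((controlledTransform π C H μ).subschemeι.app V).hom := by
      rw [RingHom.mem_ker, map_mul]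
      exact hy
    rw [Scheme.IdealSheafData.ker_subschemeι_app] at hmem
    have hs₁ := mem_ideal_of_mul_mem_of_maxOrder hX hC hπ hμ hH V hDV hmem
    rw [← Scheme.IdealSheafData.ker_subschemeι_app (controlledTransform π C H μ) V] at hs₁
    exact hs₁
  · rw [ideal_comap_of_le (controlledTransform π C H μ).subschemeι (C.comap π) V U' le_rfl, hDV,
      Ideal.map_span, Set.image_singleton, ← Scheme.Hom.app_eq_appLE]

end Local

/-! ## The restriction property -/

section Restriction

variable {X X' : Scheme.{u}} [IsLocallyNoetherian X] {π : X' ⟶ X} {C H : X.IdealSheafData} {μ : ℕ}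

omit [IsLocallyNoetherian X] in
/-- **The morphism `V(H') → V(H)` induced by the blow-up exists**, for any exponent
(`π^*H ⊆ (π^*H : 𝓘(D)^μ) = H'`). [cite: BierstoneGrigorievMilmanWlodarczyk2011, Lemma 3.6.4 (6)] -/
theorem exists_hom_subscheme_controlledTransform_pow (π : X' ⟶ X) (C H : X.IdealSheafData) (μ : ℕ) :
    ∃ πS : (controlledTransform π C H μ).subscheme ⟶ H.subscheme,
      πS ≫ H.subschemeι = (controlledTransform π C H μ).subschemeι ≫ π := by
  have hker : H.subschemeι.ker ≤ ((controlledTransform π C H μ).subschemeι ≫ π).ker := by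
    rw [Scheme.IdealSheafData.ker_subschemeι, le_ker_iff_comap_eq_bot,
      Scheme.IdealSheafData.comap_comp]
    refine le_bot_iff.mp ?_
    calc (H.comap π).comap (controlledTransform π C H μ).subschemeι
        ≤ (controlledTransform π C H μ).comap (controlledTransform π C H μ).subschemeι :=
          Scheme.IdealSheafData.comap_mono (f := (controlledTransform π C H μ).subschemeι)
            (comap_le_controlledTransform π C H μ)
      _ = ⊥ := comap_subschemeι_self _
  exact ⟨IsClosedImmersion.lift _ _ hker, IsClosedImmersion.lift_fac _ _ hker⟩

/-- **The restriction property, formal half, for any exponent**: for a blow-up `π : X' → X` along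
`C`, an ideal sheaf `H` with `π^*H ⊆ 𝓘(D)^μ`, and `H' = (π^*H : 𝓘(D)^μ)`, IF the exceptional divisor
restricts to an effective Cartier divisor on `V(H')`, then every morphism `πS : V(H') → V(H)` over
`π` is a blow-up of `V(H)` along `C|_{V(H)}` (universality: a morphism `f : W → V(H)` pulling `C`
back to a Cartier divisor lifts to `g : W → X'`; `g` lands in `V(H')` because `π^*H = 𝓘(D)^μ·H'`
with `g^*𝓘(D)^μ` Cartier and `g^*π^*H = 0`). The tree's
`IsBlowup.isBlowup_subscheme_controlledTransform_of_isEffectiveCartier` is the case `μ = 1`.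
[cite: BierstoneGrigorievMilmanWlodarczyk2011, §4 Remark (3)] -/
theorem IsBlowup.isBlowup_subscheme_controlledTransform_of_le_pow (hπ : IsBlowup π C)
    (hle : H.comap π ≤ C.comap π ^ μ)
    (hE : IsEffectiveCartier ((C.comap π).comap (controlledTransform π C H μ).subschemeι))
    (πS : (controlledTransform π C H μ).subscheme ⟶ H.subscheme)
    (hπS : πS ≫ H.subschemeι = (controlledTransform π C H μ).subschemeι ≫ π) :
    IsBlowup πS (C.comap H.subschemeι) := by
  haveI : IsProper π := hπ.isProper
  haveI : IsLocallyNoetherian X' := LocallyOfFiniteType.isLocallyNoetherian π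
  constructor
  · rw [← Scheme.IdealSheafData.comap_comp, hπS, Scheme.IdealSheafData.comap_comp]
    exact hE
  · intro W f hf
    have hf' : IsEffectiveCartier (C.comap (f ≫ H.subschemeι)) := by
      rwa [Scheme.IdealSheafData.comap_comp]
    obtain ⟨g, hg, hgu⟩ := hπ.universal (f ≫ H.subschemeι) hf'
    have hDg : IsEffectiveCartier ((C.comap π).comap g) := by
      rwa [← Scheme.IdealSheafData.comap_comp, hg]
    have hprod : (C.comap π).comap g ^ μ * (controlledTransform π C H μ).comap g = ⊥ := by
      rw [← comap_pow, ← comap_mul]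
      have h := pow_mul_controlledTransform_eq π C (I := H) (μ := μ) hπ.isEffectiveCartier hle
      rw [h, ← Scheme.IdealSheafData.comap_comp, hg, Scheme.IdealSheafData.comap_comp,
        comap_subschemeι_self, Scheme.IdealSheafData.comap_bot]
    have hle' : (controlledTransform π C H μ).subschemeι.ker ≤ g.ker := by
      rw [Scheme.IdealSheafData.ker_subschemeι, le_ker_iff_comap_eq_bot]
      exact (hDg.pow μ).eq_bot_of_mul_eq_bot hprod
    refine ⟨IsClosedImmersion.lift (controlledTransform π C H μ).subschemeι g hle', ?_, ?_⟩
    · show IsClosedImmersion.lift (controlledTransform π C H μ).subschemeι g hle' ≫ πS = f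
      rw [← cancel_mono H.subschemeι, Category.assoc, hπS, IsClosedImmersion.lift_fac_assoc, hg]
    · intro g' hg'
      change g' ≫ πS = f at hg'
      rw [← cancel_mono (controlledTransform π C H μ).subschemeι, IsClosedImmersion.lift_fac]
      apply hgu
      show (g' ≫ (controlledTransform π C H μ).subschemeι) ≫ π = f ≫ H.subschemeι
      rw [Category.assoc, ← hπS, ← Category.assoc, hg']

/-- **THE RESTRICTION PROPERTY AT MAXIMAL ORDER.** Let `X` be locally Noetherian and regular,
`π : X' → X` a blow-up along `C` with `V(C)` regular, and `H` a hypersurface (principal stalks) of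
order `μ` at every point of `V(C)`. Then every morphism `πS : V(H') → V(H)` over `π`,
`H' = (π^*H : 𝓘(D)^μ)` the weak = strict transform, is a blow-up of `V(H)` along `C|_{V(H)}`:
"`B_{Z ∩ S} S` is naturally identified with the birational transform `π_*^{-1} S`" (Kollár 3.30.2)
for the singular hypersurface `S = V(H)` with `mult_Z S = μ` (Kollár 3.60). The tree's
`IsBlowup.isBlowup_subscheme_controlledTransform` is the regular case `μ = 1`.
[cite: Kollar2007, 3.30.2, 3.58–3.60] [cite: BierstoneGrigorievMilmanWlodarczyk2011, §4 Remark (3)] -/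
theorem IsBlowup.isBlowup_subscheme_controlledTransform_of_maxOrder (hX : Scheme.IsRegular X)
    (hC : Scheme.IsRegular C.subscheme) (hπ : IsBlowup π C)
    (hμ : ∀ y ∈ (C.support : Set X), idealOrder H y = μ) (hH : ∀ x, (stalkIdeal H x).IsPrincipal)
    (πS : (controlledTransform π C H μ).subscheme ⟶ H.subscheme)
    (hπS : πS ≫ H.subschemeι = (controlledTransform π C H μ).subschemeι ≫ π) :
    IsBlowup πS (C.comap H.subschemeι) :=
  IsBlowup.isBlowup_subscheme_controlledTransform_of_le_pow hπ
    (comap_le_pow_comap_of_maxOrder hX hC hπ hμ hH)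
    (IsBlowup.isEffectiveCartier_comap_subschemeι_controlledTransform_of_maxOrder hX hC hπ hμ hH)
    πS hπS

end Restriction

/-! ## The ideal of the strict transform of the hypersurface -/

section StrictTransform

variable {X X' W W' : Scheme.{u}} [IsLocallyNoetherian X] {C : X.IdealSheafData} {k : W ⟶ X}
  [IsClosedImmersion k] {π : X' ⟶ X} {ρ : W' ⟶ W} {μ : ℕ}

/-- **`ker Bl_C(k) = (π^*(ker k) : 𝓘(D)^μ)` for a hypersurface `W ↪ X` of order `μ` along the
regular centre.** Let `k : W → X` be a closed immersion whose kernel `ker k` is a hypersurface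
(principal stalks) of order `μ` at every point of the regular centre `V(C)` (`X` regular, locally
Noetherian), `π : X' → X` a blow-up along `C`, `ρ : W' → W` a blow-up along `C|_W`, and
`Bl_C(k) : W' → X'` the strict-transform morphism (GW 13.91 (1)). Then `ker Bl_C(k)` is the weak
transform `(π^*(ker k) : 𝓘(D)^μ)`: both `W'` and `V(H')` are blow-ups of `W ≅ V(ker k)` along
`C|_W` (the restriction property at maximal order), hence isomorphic over `W`, and morphisms into
the blow-up `X'` over `X` are unique. The tree's `…_of_isEffectiveCartier` is `μ = 1`.
[cite: GortzWedhorn2020, Prop. 13.91 (1) and Prop. 13.96 (2)] [cite: Kollar2007, 3.30.2, 3.60] -/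
theorem IsBlowup.ker_strictTransformHom_of_maxOrder (hX : Scheme.IsRegular X)
    (hC : Scheme.IsRegular C.subscheme) (hπ : IsBlowup π C) (hρ : IsBlowup ρ (C.comap k))
    (hμ : ∀ y ∈ (C.support : Set X), idealOrder k.ker y = μ)
    (hH : ∀ x, (stalkIdeal k.ker x).IsPrincipal) :
    (hπ.strictTransformHom hρ).ker = controlledTransform π C k.ker μ := by
  obtain ⟨πS, hπS⟩ := exists_hom_subscheme_controlledTransform_pow π C k.ker μ
  have hbl : IsBlowup πS (C.comap k.ker.subschemeι) :=
    IsBlowup.isBlowup_subscheme_controlledTransform_of_maxOrder hX hC hπ hμ hH πS hπS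
  haveI : IsIso k.toImage := inferInstance
  let eS : W ≅ k.ker.subscheme := asIso k.toImage
  have heS : eS.hom ≫ k.ker.subschemeι = k := k.toImage_imageι
  have hinv : eS.inv ≫ k = k.ker.subschemeι := by
    rw [show eS.inv ≫ k = eS.inv ≫ eS.hom ≫ k.ker.subschemeι by rw [heS], eS.inv_hom_id_assoc]
  have hbl' : IsBlowup (ρ ≫ eS.hom) (C.comap k.ker.subschemeι) := by
    have h1 := hρ.comp_iso eS
    have h2 : (C.comap k).comap eS.inv = C.comap k.ker.subschemeι := by
      rw [← Scheme.IdealSheafData.comap_comp, hinv]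
    rwa [h2] at h1
  obtain ⟨e, he, -⟩ := hbl'.unique hbl
  have hj : hπ.strictTransformHom hρ = e.hom ≫ (controlledTransform π C k.ker μ).subschemeι := by
    symm
    apply hπ.eq_strictTransformHom hρ
    rw [Category.assoc, ← hπS, reassoc_of% he, heS]
  rw [hj, Scheme.Hom.ker_comp_of_isIso, Scheme.IdealSheafData.ker_subschemeι]

/-- **The induced embedding of chosen blow-ups, `Bl_{ι^*C}(V) ↪ Bl_C(X)` (`blowup.comapMap`, Kollár's
natural embedding of 3.30.2), has kernel the weak transform `(π^*(ker ι) : 𝓘(D)^μ)`** when `ker ι`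
is a hypersurface of order `μ` along the regular centre (so its image is the strict = weak transform
of `V`). [cite: Kollar2007, 3.30.2, 3.60] [cite: GortzWedhorn2020, Prop. 13.91 (1)] -/
theorem ker_comapMap_of_maxOrder {V : Scheme.{u}} (ι : V ⟶ X) [IsClosedImmersion ι]
    (hX : Scheme.IsRegular X) (C : X.IdealSheafData) (hC : Scheme.IsRegular C.subscheme)
    (hμ : ∀ y ∈ (C.support : Set X), idealOrder ι.ker y = μ)
    (hH : ∀ x, (stalkIdeal ι.ker x).IsPrincipal) :
    (blowup.comapMap C ι).ker = controlledTransform (blowup.π C) C ι.ker μ := by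
  have h : blowup.comapMap C ι =
      (blowup.isBlowup C).strictTransformHom (blowup.isBlowup (C.comap ι)) :=
    (blowup.isBlowup C).eq_strictTransformHom (blowup.isBlowup (C.comap ι)) (blowup.comapMap_π C ι)
  rw [h]
  exact IsBlowup.ker_strictTransformHom_of_maxOrder hX hC (blowup.isBlowup C)
    (blowup.isBlowup (C.comap ι)) hμ hH

end StrictTransform

end Summit.ResolutionOfSingularities.ResolutionOfSingularities.Theorems.SigmaMaxModificationsCorridor3.Helpers

end
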